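import Summits.ResolutionOfSingularities.ResolutionOfSingularities.Theorems.WeightedInvariantContactCylinderStratumLocalize
import Summits.ResolutionOfSingularities.ResolutionOfSingularities.Theorems.WeightedInvariantContactCylinderGenericSuccessor
import Mathlib.RingTheory.Polynomial.Basic
import HarnessLib

/-!
# The cylinder reading under the TORUS FACTOR `S → S[X]_𝔮` — (o44) part (c10-cyl), layer 1: the reading ring over a prime of
# the fibre is `S[X]_{P₀ S[X]}` (door `HypersurfaceCentreConstruction`, stmt-ResolutionOfSingularities-19897; rung P3
# `stub_keyRungLE_three`, clause (c10)≤3 for `ι₃ᵗ`; res-type-005, res-L1-w43-plan-1 GO #2 2026-08-27T13:57:22Z)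

Topic: `Summits/ResolutionOfSingularities/ResolutionOfSingularities/Theorems`. Helper for the door item
`HypersurfaceCentreConstruction` (stmt-ResolutionOfSingularities-19897, route `WeightedInvariant`), def-free.  Clause (c10)
(`IotaTorusFactorMonotone`, `…LE d p`) compares a position `(S, f)` with the local rings `S[X]_𝔮` of `S[X]` at primes `𝔮`
over `𝔪_S`.  For the nested letter `iotaLex Λ ι₀ (iotaCylinder ι₀ ι₁)` the lexicographic transfer (`iotaLex_le_of`, res-type-073)
needs the cylinder reading in the EQUALITY case `ι₀ (S[X]_𝔮) (f) = ι₀ S f`.  Registrar's architecture (GO #2 (iii)–(iv)): there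
the top `ι₀`-stratum of `(S[X]_𝔮, f)` is `V(P₀ S[X]_𝔮)` (`P₀` the generic prime of the top stratum of `(S, f)`), so the reading
ring is `(S[X]_𝔮)_{P₀ S[X]_𝔮} ≅ S[X]_{P₀ S[X]} = T(X)`, `T = S_{P₀}` of dimension `≤ 2`, and the comparison of readings is the
dimension-`≤ 2` torus-factor inequality for `ι₁` (res-type-057).  THIS FILE (layer 1) takes the strata identification at
`S[X]_𝔮` as a HYPOTHESIS `hE'` and proves the reading-ring identification and the resulting inequalities; layer 2 derives `hE'`
from the letter clauses of `ι₀`, and the named corollary for `Iota3.iotaFlatT` follows in a sequel.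

* `iotaCylinder_torusFactor_eq` — under `hE'`: `iotaCylinder ι₀ ι₁ (S[X]_𝔮) (f) = ι₁ (S[X]_{P₀ S[X]}) (f)` (ι₁ iso-invariant;
  `(S[X]_𝔮)_{P₀ S[X]_𝔮} ≅ S[X]_{P₀ S[X]}`, res-D-brk-1's `isLocalizationAtPrime_atPrime_map`);
* **`iotaCylinder_torusFactor_le`** — plus `hσ : ι₁ (S[X]_{P₀ S[X]}) (f) ≤ ι₁ (S_{P₀}) (f)` ⇒
  `iotaCylinder ι₀ ι₁ (S[X]_𝔮) (f) ≤ iotaCylinder ι₀ ι₁ S f`;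
* **`iotaLex_iotaCylinder_torusFactor_le`** — the (c10) inequality for `iotaLex Λ ι₀ (iotaCylinder ι₀ ι₁)` at `(S, f, 𝔮)` from
  (c10) for `ι₀` there, `hE'` in the equality case, and `hσ` (the `IotaTorusFactorMonotoneOn` binder shape).

[OURS · L1 W4.3 · (o44) (c10-cyl) layer 1]  Replaces the role of NO printed item; NOT a statement of the manuscript
[claim: Hironaka2017, status: under-review]. AI work, weaker than expert review.

## References

* H. Matsumura, Commutative Ring Theory (1987), Thm. 4.3 (localisation at a prime). [Matsumura1987]
* res-L1-w43-plan-1, GO #2 13:57:22Z architecture (i)–(iv); IOTA3-DESIGN v1.3.1 §9.5 (c10-cyl) (OURS, AI planning).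
-/

noncomputable section

open IsLocalRing Literature.AlgebraicGeometry.Resolution Polynomial
open Summit.ResolutionOfSingularities.ResolutionOfSingularities.Cruxes.HypersurfaceCentreConstruction.LocalEngine

set_option linter.dupNamespace false -- mandated namespace of this single-conjunct summit

namespace Summit.ResolutionOfSingularities.ResolutionOfSingularities.Theorems

namespace ContactCylinder

section Torus

variable {ι₀ ι₁ : (R : Type) → [CommRing R] → R → Ordinal.{0}}

/-- **The cylinder reading over a prime of the fibre, under the strata identification.**  `S` any ring, `P₀` a prime,
`𝔮 ⊂ S[X]` a prime containing `P₀ S[X]`; if the top `ι₀`-stratum of `(S[X]_𝔮, f)` is `V(P₀ S[X]_𝔮)` then for an iso-invariant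
`ι₁`: `iotaCylinder ι₀ ι₁ (S[X]_𝔮) (f) = ι₁ (S[X]_{P₀ S[X]}) (f)` (the reading ring `(S[X]_𝔮)_{P₀ S[X]_𝔮}` is `S[X]_{P₀ S[X]}`).
[OURS · L1 W4.3 · (o44) (c10-cyl)] -/
theorem iotaCylinder_torusFactor_eq (hι₁ : IotaIsoInvariant ι₁) (S : Type) [CommRing S] (f : S) (P₀ : Ideal S)
    [P₀.IsPrime] (𝔮 : Ideal S[X]) [𝔮.IsPrime] (hP₀𝔮 : P₀.map (C : S →+* S[X]) ≤ 𝔮)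
    (hE' : topStratum ι₀ (Localization.AtPrime 𝔮) (algebraMap S[X] (Localization.AtPrime 𝔮) (C f)) =
      {𝔮'' | (P₀.map (C : S →+* S[X])).map (algebraMap S[X] (Localization.AtPrime 𝔮)) ≤ 𝔮''.asIdeal}) :
    iotaCylinder ι₀ ι₁ (Localization.AtPrime 𝔮) (algebraMap S[X] (Localization.AtPrime 𝔮) (C f)) =
      ι₁ (Localization.AtPrime (P₀.map (C : S →+* S[X]))) (algebraMap S[X] _ (C f)) := by
  haveI : (P₀.map (C : S →+* S[X])).IsPrime := Ideal.isPrime_map_C_of_isPrime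
  haveI := isPrime_map_atPrime_of_le (P₀.map (C : S →+* S[X])) 𝔮 hP₀𝔮
  haveI := isLocalizationAtPrime_atPrime_map (P₀.map (C : S →+* S[X])) 𝔮 hP₀𝔮
  rw [iotaCylinder_eq_of_topStratum_eq ι₀ ι₁ _ _ hE',
    ← IsScalarTower.algebraMap_apply S[X] (Localization.AtPrime 𝔮) _ (C f)]
  -- `(S[X]_𝔮)_{P₀ S[X]_𝔮} ≅ S[X]_{P₀ S[X]}` over `S[X]`
  let e : Localization.AtPrime ((P₀.map (C : S →+* S[X])).map (algebraMap S[X] (Localization.AtPrime 𝔮))) ≃+*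
      Localization.AtPrime (P₀.map (C : S →+* S[X])) :=
    (IsLocalization.algEquiv (P₀.map (C : S →+* S[X])).primeCompl
      (Localization.AtPrime ((P₀.map (C : S →+* S[X])).map (algebraMap S[X] (Localization.AtPrime 𝔮))))
      (Localization.AtPrime (P₀.map (C : S →+* S[X])))).toRingEquiv
  have he : e (algebraMap S[X] _ (C f)) = algebraMap S[X] (Localization.AtPrime (P₀.map (C : S →+* S[X]))) (C f) :=
    (IsLocalization.algEquiv (P₀.map (C : S →+* S[X])).primeCompl
      (Localization.AtPrime ((P₀.map (C : S →+* S[X])).map (algebraMap S[X] (Localization.AtPrime 𝔮))))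
      (Localization.AtPrime (P₀.map (C : S →+* S[X])))).commutes (C f)
  rw [← he, iota_ringEquiv_atPrime _ _ hι₁ e]

/-- **(c10-cyl), layer 1: the cylinder reading does not increase under the torus factor** — given the strata identifications at
`S` (`hE`) and at `S[X]_𝔮` (`hE'`) and the dimension-`≤ 2` torus-factor inequality for the later letter at the reading rings
(`hσ : ι₁ (S[X]_{P₀ S[X]}) (f) ≤ ι₁ (S_{P₀}) (f)`). [OURS · L1 W4.3 · (o44) (c10-cyl)] -/
theorem iotaCylinder_torusFactor_le (hι₁ : IotaIsoInvariant ι₁) (S : Type) [CommRing S] (f : S) (P₀ : Ideal S) [P₀.IsPrime]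
    (hE : topStratum ι₀ S f = {𝔭 | P₀ ≤ 𝔭.asIdeal}) (𝔮 : Ideal S[X]) [𝔮.IsPrime] (hP₀𝔮 : P₀.map (C : S →+* S[X]) ≤ 𝔮)
    (hE' : topStratum ι₀ (Localization.AtPrime 𝔮) (algebraMap S[X] (Localization.AtPrime 𝔮) (C f)) =
      {𝔮'' | (P₀.map (C : S →+* S[X])).map (algebraMap S[X] (Localization.AtPrime 𝔮)) ≤ 𝔮''.asIdeal})
    (hσ : ι₁ (Localization.AtPrime (P₀.map (C : S →+* S[X]))) (algebraMap S[X] _ (C f)) ≤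
      ι₁ (Localization.AtPrime P₀) (algebraMap S (Localization.AtPrime P₀) f)) :
    iotaCylinder ι₀ ι₁ (Localization.AtPrime 𝔮) (algebraMap S[X] (Localization.AtPrime 𝔮) (C f)) ≤ iotaCylinder ι₀ ι₁ S f := by
  rw [iotaCylinder_torusFactor_eq hι₁ S f P₀ 𝔮 hP₀𝔮 hE', iotaCylinder_eq_of_topStratum_eq ι₀ ι₁ S f hE]
  exact hσ

/-- **(c10) for the nested letter at `(S, f, 𝔮)`** — the `IotaTorusFactorMonotoneOn ι₀ (iotaCylinder ι₀ ι₁)` binder shape with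
the letter-level inputs explicit: (c10) for `ι₀` at this position (`h10`), the strata identification at `S[X]_𝔮` in the
equality case (`hE'`), and `hσ`. [OURS · L1 W4.3 · (o44) (c10-cyl)] -/
theorem iotaLex_iotaCylinder_torusFactor_le (hι₁ : IotaIsoInvariant ι₁) {Λ : Ordinal.{0}}
    (hb : IotaBoundedBy Λ (iotaCylinder ι₀ ι₁)) (S : Type) [CommRing S] (f : S) (P₀ : Ideal S) [P₀.IsPrime]
    (hE : topStratum ι₀ S f = {𝔭 | P₀ ≤ 𝔭.asIdeal}) (𝔮 : Ideal S[X]) [𝔮.IsPrime] (hP₀𝔮 : P₀.map (C : S →+* S[X]) ≤ 𝔮)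
    (h10 : ι₀ (Localization.AtPrime 𝔮) (algebraMap S[X] (Localization.AtPrime 𝔮) (C f)) ≤ ι₀ S f)
    (hE' : ι₀ (Localization.AtPrime 𝔮) (algebraMap S[X] (Localization.AtPrime 𝔮) (C f)) = ι₀ S f →
      topStratum ι₀ (Localization.AtPrime 𝔮) (algebraMap S[X] (Localization.AtPrime 𝔮) (C f)) =
        {𝔮'' | (P₀.map (C : S →+* S[X])).map (algebraMap S[X] (Localization.AtPrime 𝔮)) ≤ 𝔮''.asIdeal})
    (hσ : ι₁ (Localization.AtPrime (P₀.map (C : S →+* S[X]))) (algebraMap S[X] _ (C f)) ≤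
      ι₁ (Localization.AtPrime P₀) (algebraMap S (Localization.AtPrime P₀) f)) :
    iotaLex Λ ι₀ (iotaCylinder ι₀ ι₁) (Localization.AtPrime 𝔮) (algebraMap S[X] (Localization.AtPrime 𝔮) (C f)) ≤
      iotaLex Λ ι₀ (iotaCylinder ι₀ ι₁) S f :=
  iotaLex_le_of hb h10 fun heq => iotaCylinder_torusFactor_le hι₁ S f P₀ hE 𝔮 hP₀𝔮 (hE' heq) hσ

end Torus

end ContactCylinder

end Summit.ResolutionOfSingularities.ResolutionOfSingularities.Theorems

end
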